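import Mathlib.Analysis.SpecialFunctions.Pow.Real
import Mathlib.Analysis.Calculus.Deriv.Pow
import Mathlib.Analysis.Calculus.Deriv.Add
import Mathlib.Analysis.Calculus.Deriv.Mul

/-!
# The `c`-axis lattice-parameter scale of the planar hole concentration in YBa₂Cu₃O₆₊ₓ (Liang–Bonn–Hardy 2006, Eq. (2))

The third located producer of a cuprate doping coordinate (beside the Presland–Tallon parabola,
`PreslandTallonParabola.lean`, and the thermopower scales, `ThermopowerDopingScale.lean`): for
YBa₂Cu₃O₆₊ₓ single crystals Liang, Bonn and Hardy print the empirical relation between the hole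
concentration per planar Cu, `p`, and the room-temperature `c`-axis lattice parameter,
[LiangBonnHardy2006, Eq. (2)]:
`p = 11.491 y + 5.17 × 10⁹ y⁶`, `y = 1 − c/c₀`, `c₀ = 1.18447 nm` (at 22 °C, the `x = 0` value),
with the printed remark «the second term is negligible for the low doping region (p < 0.1)».

Here the relation is a DEFINITION (`liangY`, `liangP`, `liangPofC`) and the theorems are the exact
algebra a user performs: strict monotonicity in `y ≥ 0` (hence strict DEcrease in `c ≤ c₀`), the
derivative `dp/dy = 11.491 + 3.102 × 10¹⁰ y⁵`, a two-sided ERROR-BAR bracket for a `y`-interval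
(`11.491 Δy ≤ Δp ≤ (11.491 + 3.102 × 10¹⁰ y₂⁵) Δy` on `0 ≤ y₁ ≤ y₂`), the conversion
`Δy = Δc/c₀`, and worked instances sizing the sextic term: at `y = 0.0087` (`p ≈ 0.102`) it is
`< 0.0023` (≈ 2 % of `p`, «negligible»), at `y = 0.014` (`p ≈ 0.200`) it is `> 0.038` (≈ 20 %).

Not here: any claim about which `c` belongs to which oxygen content (the paper's Table/Fig. data),
temperature corrections to `c`, or the chain-order plateaux (Eq. (1) of the paper is the parabola,
typed in `PreslandTallonParabola.lean`).

Reference: R. Liang, D. A. Bonn, W. N. Hardy, Phys. Rev. B 73 (2006) 180505(R),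
arXiv:cond-mat/0510674, Eq. (2) (held text p0003 L3–5).
AI-produced formalisation (H21, cell hubbard-downfold, seat lit-2, 2026-08-27); no facts, no
axioms beyond Mathlib's, no `sorry`.
-/

namespace Literature.MathematicalPhysics.QuantumLattice

open Real Set

noncomputable section

/-- The reduced `c`-axis contraction `y = 1 − c/c₀`, `c₀ = 1.18447` nm. [cite: LiangBonnHardy2006, Eq. (2)] -/
def liangY (c : ℝ) : ℝ := 1 - c / 1.18447

/-- `p(y) = 11.491 y + 5.17 × 10⁹ y⁶`. [cite: LiangBonnHardy2006, Eq. (2)] -/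
def liangP (y : ℝ) : ℝ := 11.491 * y + 5.17e9 * y ^ 6

/-- `p` as a function of the measured `c` (nm). [cite: LiangBonnHardy2006, Eq. (2)] -/
def liangPofC (c : ℝ) : ℝ := liangP (liangY c)

/-- Unfolding. [cite: LiangBonnHardy2006, Eq. (2)] -/
theorem liangY_def (c : ℝ) : liangY c = 1 - c / 1.18447 := rfl

/-- Unfolding. [cite: LiangBonnHardy2006, Eq. (2)] -/
theorem liangP_def (y : ℝ) : liangP y = 11.491 * y + 5.17e9 * y ^ 6 := rfl

/-- Unfolding. [cite: LiangBonnHardy2006, Eq. (2)] -/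
theorem liangPofC_def (c : ℝ) : liangPofC c = liangP (1 - c / 1.18447) := rfl

/-- `y(c₀) = 0` and `p(c₀) = 0`: the undoped end. [cite: LiangBonnHardy2006, Eq. (2)] -/
theorem liangPofC_c0 : liangY 1.18447 = 0 ∧ liangPofC 1.18447 = 0 := by
  constructor
  · unfold liangY; norm_num
  · unfold liangPofC liangP liangY; norm_num

/-- `Δy = Δc/c₀` (with the sign: a SHORTER `c` means a LARGER `y`). [cite: LiangBonnHardy2006, Eq. (2)] -/
theorem liangY_sub (c₁ c₂ : ℝ) : liangY c₁ - liangY c₂ = (c₂ - c₁) / 1.18447 := by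
  unfold liangY; ring

/-- The factorisation used for the error bars:
`p(y₂) − p(y₁) = (y₂ − y₁)(11.491 + 5.17 × 10⁹ Σ_{k=0}^{5} y₂^{5−k} y₁^k)`.
[cite: LiangBonnHardy2006, Eq. (2)] -/
theorem liangP_sub (y₁ y₂ : ℝ) : liangP y₂ - liangP y₁ =
    (y₂ - y₁) * (11.491 + 5.17e9 * (y₂ ^ 5 + y₂ ^ 4 * y₁ + y₂ ^ 3 * y₁ ^ 2 + y₂ ^ 2 * y₁ ^ 3
      + y₂ * y₁ ^ 4 + y₁ ^ 5)) := by
  unfold liangP; ring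

/-- `p` is strictly increasing in `y` on `y ≥ 0`. [cite: LiangBonnHardy2006, Eq. (2)] -/
theorem liangP_strictMonoOn : StrictMonoOn liangP (Ici 0) := by
  intro y₁ h₁ y₂ h₂ h12
  have h₁' : (0 : ℝ) ≤ y₁ := h₁
  have h₂' : (0 : ℝ) ≤ y₂ := h₂
  rw [← sub_pos, liangP_sub]
  apply mul_pos (sub_pos.mpr h12)
  positivity

/-- Hence `p` is strictly DEcreasing in the measured `c` on `c ≤ c₀`. [cite: LiangBonnHardy2006, Eq. (2)] -/
theorem liangPofC_strictAntiOn : StrictAntiOn liangPofC (Iic 1.18447) := by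
  intro c₁ h₁ c₂ h₂ h12
  have hy₂ : (0 : ℝ) ≤ liangY c₂ := by
    unfold liangY; have : c₂ ≤ 1.18447 := h₂
    have : c₂ / 1.18447 ≤ 1 := by rw [div_le_one (by norm_num)]; exact this
    linarith
  have hy₁ : (0 : ℝ) ≤ liangY c₁ := by
    unfold liangY; have : c₁ ≤ 1.18447 := h₁
    have : c₁ / 1.18447 ≤ 1 := by rw [div_le_one (by norm_num)]; exact this
    linarith
  have hlt : liangY c₂ < liangY c₁ := by
    unfold liangY
    have : c₁ / 1.18447 < c₂ / 1.18447 := div_lt_div_of_pos_right h12 (by norm_num)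
    linarith
  exact liangP_strictMonoOn hy₂ hy₁ hlt

/-- The derivative `dp/dy = 11.491 + 6 · 5.17 × 10⁹ y⁵ = 11.491 + 3.102 × 10¹⁰ y⁵`.
[cite: LiangBonnHardy2006, Eq. (2)] -/
theorem hasDerivAt_liangP (y : ℝ) : HasDerivAt liangP (11.491 + 3.102e10 * y ^ 5) y := by
  have h1 : HasDerivAt (fun z : ℝ => 11.491 * z) (11.491 * 1) y := (hasDerivAt_id y).const_mul _
  have h2 : HasDerivAt (fun z : ℝ => 5.17e9 * z ^ 6) (5.17e9 * (↑6 * y ^ 5)) y :=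
    (hasDerivAt_pow 6 y).const_mul _
  have h := h1.add h2
  have heq : 11.491 * 1 + 5.17e9 * ((6 : ℕ) * y ^ 5) = 11.491 + 3.102e10 * y ^ 5 := by
    push_cast; ring
  rw [← heq]
  exact h

/-- **Error-bar bracket**: for `0 ≤ y₁ ≤ y₂`,
`11.491 (y₂ − y₁) ≤ p(y₂) − p(y₁) ≤ (11.491 + 3.102 × 10¹⁰ y₂⁵)(y₂ − y₁)` — the linear term is a
floor on the sensitivity, the derivative at the upper end a ceiling (the sextic is convex).
[cite: LiangBonnHardy2006, Eq. (2)] -/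
theorem liangP_increment_bounds {y₁ y₂ : ℝ} (h₁ : 0 ≤ y₁) (h12 : y₁ ≤ y₂) :
    11.491 * (y₂ - y₁) ≤ liangP y₂ - liangP y₁ ∧
      liangP y₂ - liangP y₁ ≤ (11.491 + 3.102e10 * y₂ ^ 5) * (y₂ - y₁) := by
  have h₂ : 0 ≤ y₂ := le_trans h₁ h12
  have hd : 0 ≤ y₂ - y₁ := sub_nonneg.mpr h12
  rw [liangP_sub]
  constructor
  · have hS : 0 ≤ 5.17e9 * (y₂ ^ 5 + y₂ ^ 4 * y₁ + y₂ ^ 3 * y₁ ^ 2 + y₂ ^ 2 * y₁ ^ 3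
        + y₂ * y₁ ^ 4 + y₁ ^ 5) := by positivity
    nlinarith
  · -- each of the six monomials is ≤ y₂⁵
    have hp1 : y₁ ≤ y₂ := h12
    have e1 : y₂ ^ 4 * y₁ ≤ y₂ ^ 5 := by
      calc y₂ ^ 4 * y₁ ≤ y₂ ^ 4 * y₂ := by gcongr
        _ = y₂ ^ 5 := by ring
    have e2 : y₂ ^ 3 * y₁ ^ 2 ≤ y₂ ^ 5 := by
      calc y₂ ^ 3 * y₁ ^ 2 ≤ y₂ ^ 3 * y₂ ^ 2 := by gcongr
        _ = y₂ ^ 5 := by ring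
    have e3 : y₂ ^ 2 * y₁ ^ 3 ≤ y₂ ^ 5 := by
      calc y₂ ^ 2 * y₁ ^ 3 ≤ y₂ ^ 2 * y₂ ^ 3 := by gcongr
        _ = y₂ ^ 5 := by ring
    have e4 : y₂ * y₁ ^ 4 ≤ y₂ ^ 5 := by
      calc y₂ * y₁ ^ 4 ≤ y₂ * y₂ ^ 4 := by gcongr
        _ = y₂ ^ 5 := by ring
    have e5 : y₁ ^ 5 ≤ y₂ ^ 5 := by gcongr
    have hsum : y₂ ^ 5 + y₂ ^ 4 * y₁ + y₂ ^ 3 * y₁ ^ 2 + y₂ ^ 2 * y₁ ^ 3 + y₂ * y₁ ^ 4 + y₁ ^ 5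
        ≤ 6 * y₂ ^ 5 := by linarith
    have : (11.491 + 5.17e9 * (y₂ ^ 5 + y₂ ^ 4 * y₁ + y₂ ^ 3 * y₁ ^ 2 + y₂ ^ 2 * y₁ ^ 3
        + y₂ * y₁ ^ 4 + y₁ ^ 5)) ≤ 11.491 + 3.102e10 * y₂ ^ 5 := by nlinarith
    calc (y₂ - y₁) * (11.491 + 5.17e9 * (y₂ ^ 5 + y₂ ^ 4 * y₁ + y₂ ^ 3 * y₁ ^ 2 + y₂ ^ 2 * y₁ ^ 3
          + y₂ * y₁ ^ 4 + y₁ ^ 5))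
        ≤ (y₂ - y₁) * (11.491 + 3.102e10 * y₂ ^ 5) := by gcongr
      _ = (11.491 + 3.102e10 * y₂ ^ 5) * (y₂ - y₁) := by ring

/-! ## Worked instances: the size of the sextic term -/

/-- At `y = 0.0087` (`p ≈ 0.102`): the sextic term is `< 0.0023` (≈ 2 % of `p`) — the printed
«negligible for … p < 0.1». [cite: LiangBonnHardy2006, Eq. (2)] -/
theorem liangP_lowDoping_instance :
    0.102 < liangP 0.0087 ∧ liangP 0.0087 < 0.1023 ∧ liangP 0.0087 - 11.491 * 0.0087 < 0.0023 := by
  unfold liangP; norm_num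

/-- At `y = 0.014` (`p ≈ 0.200`, near full oxygenation): the sextic term exceeds `0.038` (≈ 20 %
of `p`) and the local sensitivity `dp/dy` is `> 28` (vs `11.5` at low doping).
[cite: LiangBonnHardy2006, Eq. (2)] -/
theorem liangP_highDoping_instance :
    0.199 < liangP 0.014 ∧ liangP 0.014 < 0.2 ∧ 0.038 < liangP 0.014 - 11.491 * 0.014 ∧
      (28 : ℝ) < 11.491 + 3.102e10 * (0.014 : ℝ) ^ 5 := by
  unfold liangP; norm_num

/-- **The ortho-II crystals of Doiron-Leyraud et al. (2007)** (YBa₂Cu₃O₆.₅₁, `T_c = 57.5 K`): the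
printed `c = 1.17441 ± 0.00005 nm` is mapped by Eq. (2) to `0.0995 < p < 0.0996` at the central `c`
and to `(0.0989, 0.1001)` over the printed `c` bar (monotone decreasing in `c`); the paper quotes
«p = 0.098 ± 0.001 (ref. 28)» from this relation and `p = 0.099` from `T_c` — the typed image sits
`0.0015` above the quoted central value, inside the two bars' union (recorded as found; immaterial at
the box FLOOR ±0.02). [cite: DoironLeyraudEtAl2007, Methods; LiangBonnHardy2006, Eq. (2)] -/
theorem liang2006_DL07_sample :
    0.0995 < liangPofC 1.17441 ∧ liangPofC 1.17441 < 0.0996 ∧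
      0.0989 < liangPofC 1.17446 ∧ liangPofC 1.17436 < 0.1001 := by
  norm_num [liangPofC, liangY, liangP]

end

end Literature.MathematicalPhysics.QuantumLattice
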